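import Literature.Claims.NS.Svancara2025
import Literature.Analysis.FluidPDE.EulerTimeScaling
import Literature.Analysis.FluidPDE.TaoLocalisation
import Literature.Analysis.FluidPDE.AxisymGradientField
import Summits.NavierStokesRegularity.NavierStokesRegularity.Theorems.SoloRefuteLucardoOlivaes2026
import HarnessLib

/-!
# C96 `Svancara2025` — the kernel-form data class is `{0}` (vacuity record); Step 1 (the ansatz as a
# claim over the data class) and Step 3 (the «R_c ↔ v correspondence») are false at their typed grains

D-0090 NS-CLAIMS SWEEP, ns-claims-refuter-2 (g6), refuter of record; skeleton
`Literature.Claims.NS.Svancara2025` (ns-claims-typist-6 g5, p517921); text of record OSF egxnq (2025-12-09),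
PDF sha16 b764580eab7e30d2, 4 pp. (census pin `census/texts/Svancara2025/`).

**Statement grain (Formal Statement p.4 l.1–8 × model sentence p.3 l.21–25, «v ∝ ∇R_c, ∇·v = 0,
R_c ∈ [0,1]»).** The skeleton proves that a divergence-free kernel field vanishes
(`kernelField_eq_zero_of_isDivFree`: `div(κ∇R) = κΔR`, bounded harmonic `R` is constant) and that the kernel
reading `ClaimedTheorem` holds with the rest state only (`claimedTheorem_holds`). Recorded here Theorems-side:
the data class of the kernel reading is EXACTLY `{0}` (`isDatum_and_isKernelField_iff_eq_zero`) — the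
theorem p.4 l.1–8, read with the kernel form, quantifies over the rest datum alone.

**Literal path, Step 1 (p.3 l.12–13 / l.25 as a claim over the data class p.4 l.2–4).** «Every smooth,
divergence-free, finite-energy field on ℝ³ is a kernel field `κ∇R`» is false for every kernel constant `κ`:
the tree's swirling bump `u0 = Φb • rotGenL` (C137 kit) is a datum with `curl u0 0 = (0,0,2)`, while
`curl (κ∇R) = κ • curl ∇R = 0` (`not_Step1_Ansatz`; consumed by the skeleton's `literal_of_step1`).

**Proof chain, Step 3 (p.4 l.13–16, «By the R_c ↔ v correspondence, this requires R_c(t) < R_th on a set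
of positive measure»), functions grain of the ansatz.** False for every `κ ≠ 0` (and for the family
`∀ K, Step3_Correspondence K` consumed by `claim_of_steps`): the configuration
`R(t,x) = 1/2 + (1/4) sin (x₀/(t* − t))` is smooth with values in `[1/4, 3/4]` at every time, so
`{R(t) < R_th = 0.12}` is EMPTY for all `t`, while `v = κ∇R` has the print's blow-up profile
`‖∇v(t)‖_∞ = |κ|/(4(t* − t)²)` — finite at each `t < t*`, `→ ∞` as `t → t*⁻` (P1 p.3 l.28–29)
(`not_Step3_Correspondence`, `not_forall_Step3_Correspondence`; ref-4 g5's print-faithfulness note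
09:26:39Z honoured). A bounded coherence field controls nothing about the Hessian. At `κ = 0` the blow-up
hypothesis is unsatisfiable and Step 3 holds vacuously (`step3_blowup_hyp_false_of_kappa_eq_zero`).

WHAT THIS IS NOT: not a claim about NS regularity or blow-up; not a claim about any author beyond the
typed locator.
-/

noncomputable section

set_option linter.dupNamespace false

open Set Function Filter MeasureTheory InnerProductSpace
open scoped Topology ENNReal NNReal ContDiff Laplacian RealInnerProductSpace

namespace Summit.NavierStokesRegularity.NavierStokesRegularity.Theorems.Svancara2025

open Literature.Analysis.FluidPDE Literature.Claims.NS.Svancara2025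
open Summit.NavierStokesRegularity.NavierStokesRegularity.Theorems.LucardoOlivaes2026 (u0 contDiff_u0
  hasCompactSupport_u0 isDivFree_u0 curl_u0_zero)

/-! ### The rest datum inhabits the class, and nothing else does -/

/-- The zero field is divergence free. [folklore] -/
theorem isDivFree_zero : NSWave0.IsDivFree (0 : E3 → E3) := fun x => by
  simp [NSWave0.divergence, show (0 : E3 → E3) = fun _ => (0 : E3) from rfl]

/-- The zero field is a kernel field for every kernel (constant configuration `R ≡ 0 ∈ [0,1]`).
[cite: Svancara2025, p.3 l.21–25] -/
theorem isKernelField_zero (K : Kernel) : IsKernelField K (0 : E3 → E3) :=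
  ⟨fun _ => 0, contDiff_const, fun _ => ⟨le_rfl, zero_le_one⟩, by funext x; simp [gradient]⟩

/-- **The data class of the kernel reading is exactly `{0}`**: a datum of the Formal Statement p.4 l.1–8
that is a kernel field (model sentence p.3 l.25) is the rest datum (skeleton `kernelDatum_eq_zero`), and the
rest datum qualifies (smooth, divergence free, zero energy; constant configuration `R ≡ 0`). The
statement quantifies over the rest datum only (vacuity record).
[cite: Svancara2025, §2 p.4 l.1–8; §1 p.3 l.21–25] -/
theorem isDatum_and_isKernelField_iff_eq_zero (K : Kernel) (v₀ : E3 → E3) :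
    (IsDatum v₀ ∧ IsKernelField K v₀) ↔ v₀ = 0 :=
  ⟨fun h => kernelDatum_eq_zero h.1 h.2,
    fun h => h ▸ ⟨⟨contDiff_const, isDivFree_zero, by simp⟩, isKernelField_zero K⟩⟩

/-! ### Step 1 is false: a datum with non-zero curl is not a kernel field -/

/-- A field of kernel form `κ • ∇R` with `R ∈ C²` is irrotational. [folklore] -/
theorem curl_eq_zero_of_kernelForm {R : E3 → ℝ} {κ : ℝ} {v : E3 → E3} (hR : ContDiff ℝ 2 R)
    (hvR : v = fun x => κ • gradient R x) (x : E3) : curl v x = 0 := by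
  rw [hvR, curl_const_smul_field, curl_gradient_eq_zero_holds R hR x, smul_zero]

/-- A rapidly decreasing field has finite energy (`n = 0` of the tree's Schwartz ⇒ `H^∞` lemma).
[folklore] -/
theorem energy_lt_top_of_hasRapidSpatialDecay {v : E3 → E3} (h : HasRapidSpatialDecay v) :
    (∫⁻ x, ‖v x‖ₑ ^ 2) < ⊤ := by
  have h0 := h.lintegral_enorm_iteratedFDeriv_sq_lt_top (μ := volume) 0
  refine lt_of_le_of_lt (le_of_eq (lintegral_congr fun x => ?_)) h0
  rw [← ofReal_norm, ← ofReal_norm, norm_iteratedFDeriv_zero]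

/-- The swirling bump `u0` (smooth, compactly supported, divergence free) is a datum of the class
p.4 l.2–4. [cite: Svancara2025, p.4 l.2–4] -/
theorem isDatum_u0 : IsDatum u0 :=
  ⟨contDiff_u0, isDivFree_u0, energy_lt_top_of_hasRapidSpatialDecay
    (HasRapidSpatialDecay.of_hasCompactSupport contDiff_u0 hasCompactSupport_u0)⟩

/-- The swirling bump is not a kernel field, for any kernel: `curl u0 0 = (0,0,2) ≠ 0 = curl (κ∇R) 0`.
[cite: Svancara2025, p.3 l.25] -/
theorem not_isKernelField_u0 (K : Kernel) : ¬ IsKernelField K u0 := by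
  rintro ⟨R, hR, -, hu⟩
  have h1 : curl u0 0 = 0 := curl_eq_zero_of_kernelForm (hR.of_le (by norm_cast)) hu 0
  have h2 := congrArg (fun w : E3 => w 2) h1
  simp [curl_u0_zero] at h2

/-- **Step 1 (the ansatz «v ∝ ∇R_c» as a claim over the data class, p.3 l.12–13 / l.25) is false** for
every kernel: the datum `u0` is not a kernel field. Type-exact on the literal path
(`literal_of_step1 : Step1_Ansatz K → ClaimedTheoremLiteral`). Class: false lemma (countermodel).
[cite: Svancara2025, p.3 l.12–13, l.25; p.4 l.2–4] -/
theorem not_Step1_Ansatz (K : Kernel) : ¬ Step1_Ansatz K := fun h =>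
  not_isKernelField_u0 K (h u0 isDatum_u0)

/-! ### Step 3 is false at the functions grain: a bounded configuration oscillating faster as `t → t*`

Print-faithful blow-up profile (P1 p.3 l.28–29 is `lim sup_{t→t*⁻} ‖∇v(t)‖_∞ = ∞`): the witness below has
`‖∇v(t)‖_∞ = |κ| N(t)²/4 < ∞` at every fixed `t < t*`, `N(t) = 1/(t* − t)`, and `→ ∞` as `t → t*⁻`, while the
coherence field stays in `[1/4, 3/4]` — never below `R_th = 0.12` — at every time. -/

/-- The one-dimensional profile `g_N(s) = 1/2 + (1/4) sin(N s)`. [folklore] -/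
def gN (N s : ℝ) : ℝ := 1/2 + 1/4 * Real.sin (N * s)

/-- `g_N'(s) = (1/4) cos(N s) N`. [folklore] -/
def gN' (N s : ℝ) : ℝ := 1/4 * (Real.cos (N * s) * N)

/-- `g_N''(s) = (1/4) (−sin(N s) N) N`. [folklore] -/
def gN'' (N s : ℝ) : ℝ := 1/4 * (-Real.sin (N * s) * N * N)

/-- `g_N` is smooth in `s`. [folklore] -/
theorem contDiff_gN (N : ℝ) : ContDiff ℝ ∞ (gN N) :=
  contDiff_const.add (contDiff_const.mul (Real.contDiff_sin.comp (contDiff_const.mul contDiff_id)))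

/-- `g_N'` is the derivative of `g_N`. [folklore] -/
theorem hasDerivAt_gN (N s : ℝ) : HasDerivAt (gN N) (gN' N s) s := by
  have h1 : HasDerivAt (fun x : ℝ => N * x) N s := by simpa using (hasDerivAt_id s).const_mul N
  exact ((h1.sin).const_mul (1/4 : ℝ)).const_add (1/2 : ℝ)

/-- `g_N''` is the derivative of `g_N'`. [folklore] -/
theorem hasDerivAt_gN' (N s : ℝ) : HasDerivAt (gN' N) (gN'' N s) s := by
  have h1 : HasDerivAt (fun x : ℝ => N * x) N s := by simpa using (hasDerivAt_id s).const_mul N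
  exact ((h1.cos).mul_const N).const_mul (1/4 : ℝ)

/-- `g_N` takes values in `[1/4, 3/4] ⊆ [0,1]`. [folklore] -/
theorem gN_mem (N s : ℝ) : gN N s ∈ Icc (1/4 : ℝ) (3/4) := by
  unfold gN
  constructor <;> nlinarith [Real.sin_le_one (N * s), Real.neg_one_le_sin (N * s)]

/-- At `s = π/(2N)` the second derivative is `−N²/4` (`N ≠ 0`). [folklore] -/
theorem gN''_at (N : ℝ) (hN : N ≠ 0) : gN'' N (Real.pi / (2 * N)) = -(N ^ 2) / 4 := by
  have h : N * (Real.pi / (2 * N)) = Real.pi / 2 := by field_simp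
  unfold gN''
  rw [h, Real.sin_pi_div_two]
  ring

/-- The oscillation frequency `N(t) = 1/(t* − t)`. [folklore] -/
def Nof (tstar t : ℝ) : ℝ := 1 / (tstar - t)

/-- The countermodel configuration `R(t,x) = g_{N(t)}(x₀) = 1/2 + (1/4) sin(x₀/(t* − t))` on `ℝ³`.
[folklore] -/
def Rosc (tstar t : ℝ) (x : E3) : ℝ := gN (Nof tstar t) (x 0)

/-- The first coordinate vector `e₀`. [folklore] -/
def e0 : E3 := EuclideanSpace.single 0 1

/-- Each `R(t,·)` is smooth. [folklore] -/
theorem contDiff_Rosc (tstar t : ℝ) : ContDiff ℝ ∞ (Rosc tstar t) :=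
  (contDiff_gN _).comp (EuclideanSpace.proj (0 : Fin 3) : E3 →L[ℝ] ℝ).contDiff

/-- `R` takes values in `[0,1]` (indeed in `[1/4, 3/4]`). [folklore] -/
theorem Rosc_mem (tstar t : ℝ) (x : E3) : Rosc tstar t x ∈ Icc (0 : ℝ) 1 := by
  have h := gN_mem (Nof tstar t) (x 0)
  simp only [Rosc, mem_Icc] at h ⊢
  constructor <;> linarith [h.1, h.2]

/-- `R ≥ 1/4 > R_th` everywhere, at every time: the sub-threshold set is empty.
[cite: Svancara2025, abstract p.3 l.13–14] -/
theorem setOf_Rosc_lt_Rth_eq_empty (tstar t : ℝ) : {x : E3 | Rosc tstar t x < Rth} = ∅ := by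
  ext x
  simp only [mem_setOf_eq, mem_empty_iff_false, iff_false, not_lt]
  have h := (gN_mem (Nof tstar t) (x 0)).1
  unfold Rosc
  rw [Rth]
  linarith

/-- Chain rule along the first coordinate: `D(h ∘ x₀)(x) = h'(x₀) • proj₀`. [folklore] -/
theorem hasFDerivAt_comp_coord0 {h : ℝ → ℝ} {h' : ℝ} {x : E3} (hh : HasDerivAt h h' (x 0)) :
    HasFDerivAt (fun y : E3 => h (y 0)) (h' • (EuclideanSpace.proj (0 : Fin 3) : E3 →L[ℝ] ℝ)) x :=
  hh.comp_hasFDerivAt x (EuclideanSpace.proj (0 : Fin 3) : E3 →L[ℝ] ℝ).hasFDerivAt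

/-- `DR(t)(y) e₀ = g_N'(y₀)`. [folklore] -/
theorem fderiv_Rosc_e0 (tstar t : ℝ) (y : E3) :
    fderiv ℝ (Rosc tstar t) y e0 = gN' (Nof tstar t) (y 0) := by
  rw [show Rosc tstar t = fun y : E3 => gN (Nof tstar t) (y 0) from rfl,
    (hasFDerivAt_comp_coord0 (hasDerivAt_gN _ (y 0))).fderiv]
  simp [e0]

/-- `D(y ↦ DR(t)(y) e₀)(x) e₀ = g_N''(x₀)`. [folklore] -/
theorem fderiv_fderiv_Rosc_e0 (tstar t : ℝ) (x : E3) :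
    fderiv ℝ (fun y => fderiv ℝ (Rosc tstar t) y e0) x e0 = gN'' (Nof tstar t) (x 0) := by
  rw [show (fun y => fderiv ℝ (Rosc tstar t) y e0) = fun y : E3 => gN' (Nof tstar t) (y 0) from
      funext (fderiv_Rosc_e0 tstar t), (hasFDerivAt_comp_coord0 (hasDerivAt_gN' _ (x 0))).fderiv]
  simp [e0]

/-- `(D∇R(t)(x) e₀)₀ = g_N''(x₀)`. [folklore] -/
theorem fderiv_gradient_Rosc_e0 (tstar t : ℝ) (x : E3) :
    fderiv ℝ (gradient (Rosc tstar t)) x e0 0 = gN'' (Nof tstar t) (x 0) := by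
  rw [show e0 = EuclideanSpace.single (0 : Fin 3) (1 : ℝ) from rfl,
    fderiv_gradient_apply_coord ((contDiff_Rosc tstar t).of_le (by norm_cast)) x _ 0]
  exact fderiv_fderiv_Rosc_e0 tstar t x

/-- The countermodel velocity `v(t) = κ∇R(t)`. [folklore] -/
def vosc (K : Kernel) (tstar t : ℝ) (x : E3) : E3 := K.κ • gradient (Rosc tstar t) x

/-- `‖Dv(t)(x)‖ ≥ |κ| |g_N''(x₀)|`. [folklore] -/
theorem norm_fderiv_vosc_ge (K : Kernel) (tstar t : ℝ) (x : E3) :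
    |K.κ| * |gN'' (Nof tstar t) (x 0)| ≤ ‖fderiv ℝ (vosc K tstar t) x‖ := by
  have hgrad : ContDiff ℝ 1 (gradient (Rosc tstar t)) :=
    (InnerProductSpace.toDual ℝ E3).symm.contDiff.comp
      ((contDiff_Rosc tstar t).fderiv_right (m := 1) (by norm_cast))
  have hdx : DifferentiableAt ℝ (gradient (Rosc tstar t)) x := hgrad.differentiable one_ne_zero x
  have hfd : fderiv ℝ (vosc K tstar t) x = K.κ • fderiv ℝ (gradient (Rosc tstar t)) x := by
    rw [show vosc K tstar t = K.κ • gradient (Rosc tstar t) from rfl, fderiv_const_smul hdx]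
  have he0 : ‖e0‖ = 1 := by simp [e0]
  have h1 : ‖fderiv ℝ (vosc K tstar t) x e0‖ ≤ ‖fderiv ℝ (vosc K tstar t) x‖ := by
    have := (fderiv ℝ (vosc K tstar t) x).le_opNorm e0
    rwa [he0, mul_one] at this
  have h2 : |fderiv ℝ (vosc K tstar t) x e0 0| ≤ ‖fderiv ℝ (vosc K tstar t) x e0‖ := by
    have := PiLp.norm_apply_le (fderiv ℝ (vosc K tstar t) x e0) 0
    rwa [Real.norm_eq_abs] at this
  have h3 : fderiv ℝ (vosc K tstar t) x e0 0 = K.κ * gN'' (Nof tstar t) (x 0) := by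
    rw [hfd]
    simp only [FunLike.coe_smul, Pi.smul_apply, PiLp.smul_apply, smul_eq_mul,
      fderiv_gradient_Rosc_e0]
  rw [← abs_mul, ← h3]
  exact h2.trans h1

/-- `|g_N''| ≤ N²/4`. [folklore] -/
theorem abs_gN''_le (N s : ℝ) : |gN'' N s| ≤ N ^ 2 / 4 := by
  have h2 : |-Real.sin (N * s) * N * N| ≤ N ^ 2 := by
    rw [abs_mul, abs_mul, abs_neg]
    calc |Real.sin (N * s)| * |N| * |N| ≤ 1 * |N| * |N| := by
          gcongr; exact Real.abs_sin_le_one _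
      _ = N ^ 2 := by rw [one_mul, ← sq, sq_abs]
  unfold gN''
  rw [abs_mul, abs_of_pos (by norm_num : (0:ℝ) < 1/4)]
  linarith

/-- The gradient of the configuration is `∇R(t)(x) = g_N'(x₀) e₀`. [folklore] -/
theorem gradient_Rosc (tstar t : ℝ) (x : E3) :
    gradient (Rosc tstar t) x = gN' (Nof tstar t) (x 0) • e0 := by
  rw [gradient, show Rosc tstar t = fun y : E3 => gN (Nof tstar t) (y 0) from rfl,
    (hasFDerivAt_comp_coord0 (hasDerivAt_gN _ (x 0))).fderiv, map_smul]
  congr 1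
  apply (InnerProductSpace.toDual ℝ E3).injective
  rw [LinearIsometryEquiv.apply_symm_apply]
  ext y
  rw [InnerProductSpace.toDual_apply_apply]
  simp [e0, EuclideanSpace.inner_single_left]

/-- **Print-faithfulness of the witness: at each fixed time the gradient is bounded**,
`‖Dv(t)(x)‖ ≤ |κ| N(t)²/4` for all `x` (so `‖∇v(t)‖_∞ < ∞` for `t < t*`, blowing up only as `t → t*⁻`,
exactly the profile of P1 p.3 l.28–29). [cite: Svancara2025, p.3 l.26–29] -/
theorem norm_fderiv_vosc_le (K : Kernel) (tstar t : ℝ) (x : E3) :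
    ‖fderiv ℝ (vosc K tstar t) x‖ ≤ |K.κ| * ((Nof tstar t) ^ 2 / 4) := by
  set N := Nof tstar t
  have hc : HasFDerivAt (fun y : E3 => K.κ * gN' N (y 0))
      (K.κ • (gN'' N (x 0) • (EuclideanSpace.proj (0 : Fin 3) : E3 →L[ℝ] ℝ))) x :=
    (hasFDerivAt_comp_coord0 (hasDerivAt_gN' N (x 0))).const_mul K.κ
  have hv : vosc K tstar t = fun y : E3 => (K.κ * gN' N (y 0)) • e0 := by
    funext y; rw [vosc, gradient_Rosc, smul_smul]
  rw [hv, (hc.smul_const e0).fderiv, ContinuousLinearMap.norm_smulRight_apply, norm_smul, norm_smul,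
    show ‖e0‖ = 1 by simp [e0], mul_one, Real.norm_eq_abs, Real.norm_eq_abs]
  have hproj : ‖(EuclideanSpace.proj (0 : Fin 3) : E3 →L[ℝ] ℝ)‖ ≤ 1 :=
    ContinuousLinearMap.opNorm_le_bound _ zero_le_one fun y => by
      simpa using PiLp.norm_apply_le y 0
  have hprod : |gN'' N (x 0)| * ‖(EuclideanSpace.proj (0 : Fin 3) : E3 →L[ℝ] ℝ)‖ ≤ N ^ 2 / 4 * 1 :=
    mul_le_mul (abs_gN''_le N (x 0)) hproj (norm_nonneg _) (by positivity)
  calc |K.κ| * (|gN'' N (x 0)| * ‖(EuclideanSpace.proj (0 : Fin 3) : E3 →L[ℝ] ℝ)‖)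
      ≤ |K.κ| * (N ^ 2 / 4 * 1) := mul_le_mul_of_nonneg_left hprod (abs_nonneg _)
    _ = |K.κ| * (N ^ 2 / 4) := by ring

/-- Along `t_n = t* − t*/(n+1) ↑ t*` the gradient exceeds every bound: `‖Dv(t_n)(x_n)‖ ≥ |κ| N_n²/4`,
`N_n = (n+1)/t*`, `x_n = (π/(2N_n)) e₀` (`κ ≠ 0`). [folklore] -/
theorem fderiv_vosc_unbounded (K : Kernel) (hκ : K.κ ≠ 0) {tstar : ℝ} (hts : 0 < tstar) (M : ℝ) :
    ∃ t ∈ Ico 0 tstar, ∃ x : E3, M < ‖fderiv ℝ (vosc K tstar t) x‖ := by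
  have hκ' : 0 < |K.κ| := abs_pos.2 hκ
  obtain ⟨n, hn⟩ := exists_nat_gt (4 * tstar ^ 2 * M / |K.κ|)
  have hn1 : (0 : ℝ) < n + 1 := by positivity
  set t : ℝ := tstar - tstar / (n + 1) with ht
  set N : ℝ := (n + 1) / tstar with hN
  have hNpos : 0 < N := by positivity
  have hNof : Nof tstar t = N := by
    rw [Nof, ht, hN]; field_simp; ring
  refine ⟨t, ⟨?_, ?_⟩, (Real.pi / (2 * N)) • e0, ?_⟩
  · rw [ht, sub_nonneg, div_le_iff₀ hn1]; nlinarith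
  · rw [ht, sub_lt_self_iff]; positivity
  have hx0 : ((Real.pi / (2 * N)) • e0) 0 = Real.pi / (2 * N) := by simp [e0]
  have hle := norm_fderiv_vosc_ge K tstar t ((Real.pi / (2 * N)) • e0)
  rw [hx0, hNof, gN''_at N hNpos.ne', abs_div, abs_neg, abs_pow, abs_of_pos hNpos,
    abs_of_pos (by norm_num : (0:ℝ) < 4)] at hle
  have hM : M < |K.κ| * (N ^ 2 / 4) := by
    rw [div_lt_iff₀ hκ'] at hn
    have hN2 : (n + 1 : ℝ) / tstar ^ 2 * (n + 1) = N ^ 2 := by rw [hN]; ring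
    have h1 : (n : ℝ) < (n + 1) * (n + 1) := by nlinarith
    have h2 : 4 * tstar ^ 2 * M < |K.κ| * ((n + 1) * (n + 1)) :=
      hn.trans (by nlinarith)
    have h3 : |K.κ| * (N ^ 2 / 4) = |K.κ| * ((n + 1) * (n + 1)) / (4 * tstar ^ 2) := by
      rw [hN]; field_simp
    rw [h3, lt_div_iff₀ (by positivity)]
    linarith
  exact hM.trans_le hle

/-- **Step 3 («By the R_c ↔ v correspondence, this requires R_c(t) < R_th on a set of positive measure»,
p.4 l.13–16) is false at its typed (functions) grain for every kernel constant `κ ≠ 0`**: the configuration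
`R(t,x) = 1/2 + (1/4) sin(x₀/(t* − t))` stays in `[1/4, 3/4]` at every time (never below `R_th = 0.12`,
the sub-threshold set is EMPTY) while `v = κ∇R` has `‖∇v(t)‖_∞ = |κ|/(4(t* − t)²) → ∞` as `t → t*⁻`
(finite at each fixed `t < t*`, as in P1 p.3 l.28–29). Class: false lemma (countermodel).
[cite: Svancara2025, §2 p.4 l.13–16; p.3 l.26–29] -/
theorem not_Step3_Correspondence (K : Kernel) (hκ : K.κ ≠ 0) : ¬ Step3_Correspondence K := by
  intro h
  obtain ⟨t, -, hvol⟩ := h (Rosc 1) (vosc K 1) 1 one_pos (fun t _ => contDiff_Rosc 1 t)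
    (fun t _ x => Rosc_mem 1 t x) (fun _ _ => rfl) (fderiv_vosc_unbounded K hκ one_pos)
  rw [setOf_Rosc_lt_Rth_eq_empty, measure_empty] at hvol
  exact lt_irrefl _ hvol

/-- **The family `∀ K, Step3_Correspondence K` consumed by `claim_of_steps` fails** (witness kernel
`κ = 1`). [cite: Svancara2025, §2 p.4 l.13–16] -/
theorem not_forall_Step3_Correspondence : ¬ ∀ K : Kernel, Step3_Correspondence K := fun h =>
  not_Step3_Correspondence ⟨1, fun _ => True⟩ one_ne_zero (h _)

/-- For `κ = 0` the blow-up hypothesis of Step 3 is unsatisfiable (`v ≡ 0`), so `Step3_Correspondence K`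
holds vacuously there — recorded so that the side condition `κ ≠ 0` above is seen to be sharp.
[cite: Svancara2025, §2 p.4 l.13–16] -/
theorem step3_blowup_hyp_false_of_kappa_eq_zero (K : Kernel) (hκ : K.κ = 0) {R : ℝ → E3 → ℝ}
    {v : ℝ → E3 → E3} {tstar : ℝ} (hv : ∀ t ∈ Ico 0 tstar, v t = fun x => K.κ • gradient (R t) x) :
    ¬ ∀ M : ℝ, ∃ t ∈ Ico 0 tstar, ∃ x : E3, M < ‖fderiv ℝ (v t) x‖ := by
  intro h
  obtain ⟨t, ht, x, hx⟩ := h 0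
  rw [hv t ht, hκ] at hx
  simp at hx

end Summit.NavierStokesRegularity.NavierStokesRegularity.Theorems.Svancara2025
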